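import Literature.MathematicalPhysics.QuantumLattice.HubbardFermionInteractionLocalHamiltonian
import Literature.MathematicalPhysics.QuantumLattice.InfVolFermionStateBounds
import HarnessLib

/-!
# The Hubbard energy density of a translation-invariant state versus its box Hamiltonians

Topic `Literature/MathematicalPhysics/QuantumLattice`; namespace
`Literature.MathematicalPhysics.QuantumLattice` (the file path). Companion of
`InfVolFermionState.lean`, `HubbardFermionInteractionTerms.lean`,
`HubbardFermionInteractionLocalHamiltonian.lean`, `InfVolFermionStateBounds.lean`: for a
TRANSLATION-INVARIANT infinite-volume state `ω` of the lattice fermion system on `ℤ^d`, the Hubbard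
energy density `e(ω) = Re ω(E_Φ)` and the expectations of the free-boundary box Hamiltonians
`H_Λ = Σ_{X ⊆ Λ} Φ(X)` are both expressed through the on-site energy `u = ω(Φ{0})` and the `d`
bond energies `h_i = ω(Φ{0, e_i})`; for the boxes `[0,ℓ)² ⊆ ℤ²` they differ by a boundary term
`O(ℓ)`: `|ℓ² e(ω) - Re ω(H_{[0,ℓ)²})| ≤ 8|t| ℓ` — the canonical first step of the variational
principle for the energy density (Bratteli–Robinson II §6.2.4, Prop. 6.2.38 ff.: the mean energy
of a periodic state is `lim ω(H_Λ)/|Λ|`). Everything is PROVED; no definition, no named fact.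

## Results

* `IsTranslationInvariant.expect_hubbard_singleton`, `.expect_hubbard_pair`: the expectations of
  the on-site and bond terms do not depend on their position.
* `IsTranslationInvariant.expect_hubbard_meanEnergyObs`: `ω(E_Φ) = u + Σ_i h_i`.
* `IsTranslationInvariant.expect_hubbard_localHamiltonian`:
  `ω(H_Λ) = |Λ| u + Σ_i #{x ∈ Λ : x + e_i ∈ Λ} h_i` for every finite `Λ`.
* `abs_re_expect_hubbard_pair_le`: `|Re h_i| ≤ 4|t|`.
* `IsTranslationInvariant.abs_sq_mul_hubbardEnergyDensity_sub_re_expect_localHamiltonian_le`: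
  `|ℓ² e(ω) - Re ω(H_{[0,ℓ)²})| ≤ 8|t| ℓ` (two dimensions).
-/

noncomputable section

namespace Literature.MathematicalPhysics.QuantumLattice

open Matrix Finset HubbardWave0 Literature.Probability.LatticeModels
open scoped ComplexOrder

variable {d : ℕ} (t U : ℝ)

namespace InfVolFermionState

/-! ### Translation invariance of the term expectations -/

/-- `shiftSet x {0} ⊆ {x}`. [folklore] -/
theorem shiftSet_singleton_zero_subset (x : Site d) : shiftSet x ({0} : Finset (Site d)) ⊆ {x} := by
  intro y hy
  rw [mem_shiftSet, mem_singleton, sub_eq_zero] at hy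
  rw [mem_singleton, hy]

/-- `shiftSet x {0, 0 + e_i} ⊆ {x, x + e_i}`. [folklore] -/
theorem shiftSet_pair_zero_subset (x : Site d) (i : Fin d) :
    shiftSet x ({0, 0 + unitVec i} : Finset (Site d)) ⊆ {x, x + unitVec i} := by
  intro y hy
  rw [mem_shiftSet, mem_insert, mem_singleton] at hy
  rw [mem_insert, mem_singleton]
  rcases hy with h | h
  · exact Or.inl (sub_eq_zero.1 h)
  · right; rw [zero_add] at h; rw [← sub_add_cancel y x, h, add_comm]

variable {ω : InfVolFermionState d}

/-- **The on-site energy does not depend on the site**: for translation-invariant `ω`,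
`ω(Φ{x}) = ω(Φ{0})`. [cite: BratteliRobinsonI1987, §4.3.1] -/
theorem IsTranslationInvariant.expect_hubbard_singleton (hω : ω.IsTranslationInvariant) (x : Site d) :
    ω.expect {x} ((hubbardFermionInteraction d t U).Φ {x}) =
      ω.expect {0} ((hubbardFermionInteraction d t U).Φ {0}) := by
  conv_rhs => rw [← hω x, shift_expect]
  refine ω.expect_fermionEmbed_incl_eq (subset_refl {x}) (shiftSet_singleton_zero_subset x) _ _ ?_
  have hpt : ∀ (h : 0 + x ∈ ({x} : Finset (Site d))) (h' : x ∈ ({x} : Finset (Site d))),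
      (PolySite.pt (0 + x) h : PolySite ({x} : Finset (Site d))) = PolySite.pt x h' := fun h h' =>
    Subtype.ext (congrArg toLex (zero_add x))
  simp only [hubbardFermionInteraction_apply_singleton, fermionEmbed_smul, fermionEmbed_mul,
    fermionEmbed_numberOp, PolySite.shiftEmb_pt, PolySite.incl_pt]
  rw [hpt _ (mem_singleton_self x)]

/-- **The bond energy does not depend on the bond**: for translation-invariant `ω`,
`ω(Φ{x, x + e_i}) = ω(Φ{0, e_i})`. [cite: BratteliRobinsonI1987, §4.3.1] -/
theorem IsTranslationInvariant.expect_hubbard_pair (hω : ω.IsTranslationInvariant) (x : Site d) (i : Fin d) :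
    ω.expect {x, x + unitVec i} ((hubbardFermionInteraction d t U).Φ {x, x + unitVec i}) =
      ω.expect {0, 0 + unitVec i} ((hubbardFermionInteraction d t U).Φ {0, 0 + unitVec i}) := by
  conv_rhs => rw [← hω x, shift_expect]
  refine ω.expect_fermionEmbed_incl_eq (subset_refl _) (shiftSet_pair_zero_subset x i) _ _ ?_
  have hc : ∀ (y : Site d) (hy : y ∈ ({0, 0 + unitVec i} : Finset (Site d))) (σ : Fin 2),
      fermionEmbed ((PolySite.shiftEmb x {0, 0 + unitVec i}).trans (PolySite.incl (shiftSet_pair_zero_subset x i)))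
        (cAt y hy σ) = cAt (y + x) (shiftSet_pair_zero_subset x i (PolySite.add_mem_shiftSet x hy)) σ := by
    intro y hy σ
    rw [cAt, fermionEmbed_annihilation]
    rfl
  have h0 : ∀ (h : 0 + x ∈ ({x, x + unitVec i} : Finset (Site d))) (h' : x ∈ ({x, x + unitVec i} : Finset (Site d)))
      (σ : Fin 2), cAt (0 + x) h σ = cAt x h' σ := fun h h' σ => cAt_congr h h' (zero_add x) σ
  have h1 : ∀ (h : 0 + unitVec i + x ∈ ({x, x + unitVec i} : Finset (Site d)))
      (h' : x + unitVec i ∈ ({x, x + unitVec i} : Finset (Site d))) (σ : Fin 2),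
      cAt (0 + unitVec i + x) h σ = cAt (x + unitVec i) h' σ := fun h h' σ =>
    cAt_congr h h' (by rw [zero_add, add_comm]) σ
  simp only [hubbardFermionInteraction_apply_pair, fermionEmbed_smul, fermionEmbed_sum, fermionEmbed_add,
    fermionEmbed_mul, fermionEmbed_conjTranspose, fermionEmbed_fermionEmbed, fermionEmbed_incl_cAt, hc,
    h0 _ (mem_insert_self _ _), h1 _ (mem_insert_of_mem (mem_singleton_self _))]

/-! ### The mean energy and the box Hamiltonians through `u` and `h_i` -/

/-- **The energy density through the term expectations**: for translation-invariant `ω`,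
`ω(E_Φ) = ω(Φ{0}) + Σ_i ω(Φ{0, e_i})` (the two half bonds through the origin in direction `i`
have the same expectation). [cite: BratteliKishimotoRobinson1978, §3 (mean energy functional)] -/
theorem IsTranslationInvariant.expect_hubbard_meanEnergyObs (hω : ω.IsTranslationInvariant) :
    ω.expect (thicken ({0} : Finset (Site d)) 1) ((hubbardFermionInteraction d t U).meanEnergyObs 1) =
      ω.expect {0} ((hubbardFermionInteraction d t U).Φ {0}) +
        ∑ i : Fin d, ω.expect {0, 0 + unitVec i} ((hubbardFermionInteraction d t U).Φ {0, 0 + unitVec i}) := by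
  rw [hubbardFermionInteraction_meanEnergyObs, map_add, map_sum, ω.compatible]
  congr 1
  refine Finset.sum_congr rfl fun i _ => ?_
  rw [map_add, map_smul, map_smul, ω.compatible, ω.compatible]
  have h := hω.expect_hubbard_pair t U (-unitVec i) i
  rw [h, ← add_smul]
  norm_num

/-- **The box Hamiltonians through the term expectations**: for translation-invariant `ω` and
every finite region `Λ`, `ω(H_Λ) = |Λ| ω(Φ{0}) + Σ_i #{x ∈ Λ : x + e_i ∈ Λ} ω(Φ{0, e_i})`.
[cite: BratteliRobinsonII1997, §6.2.4 (Prop. 6.2.38 ff.)] -/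
theorem IsTranslationInvariant.expect_hubbard_localHamiltonian (hω : ω.IsTranslationInvariant)
    (Λ : Finset (Site d)) :
    ω.expect Λ ((hubbardFermionInteraction d t U).localHamiltonian Λ) =
      (Λ.card : ℂ) * ω.expect {0} ((hubbardFermionInteraction d t U).Φ {0}) +
        ∑ i : Fin d, ((Λ.filter fun x => x + unitVec i ∈ Λ).card : ℂ) *
          ω.expect {0, 0 + unitVec i} ((hubbardFermionInteraction d t U).Φ {0, 0 + unitVec i}) := by
  classical
  rw [FermionInteraction.localHamiltonian_eq_sum, map_sum]
  have hterm : ∀ X : Finset (Site d), ω.expect Λ (if h : X ⊆ Λ then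
      fermionEmbed (PolySite.incl h) ((hubbardFermionInteraction d t U).Φ X) else 0) =
      if X ⊆ Λ then ω.expect X ((hubbardFermionInteraction d t U).Φ X) else 0 := by
    intro X
    by_cases h : X ⊆ Λ
    · rw [dif_pos h, if_pos h, ω.compatible]
    · rw [dif_neg h, if_neg h, map_zero]
  simp_rw [hterm]
  rw [sum_powerset_eq_of_hubbard_support Λ _ (fun X h1 h2 => by
    rw [hubbardFermionInteraction_apply_eq_zero t U h1 h2, map_zero, ite_self])]
  congr 1
  · rw [Finset.sum_congr rfl fun x hx => by rw [if_pos (singleton_subset_iff.2 hx), hω.expect_hubbard_singleton t U x],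
      sum_const, nsmul_eq_mul]
  · rw [Finset.sum_filter, Finset.sum_product, Finset.sum_comm]
    refine Finset.sum_congr rfl fun i _ => ?_
    rw [Finset.card_filter, Nat.cast_sum, Finset.sum_mul]
    refine Finset.sum_congr rfl fun x hx => ?_
    by_cases h : x + unitVec i ∈ Λ
    · rw [if_pos h, if_pos (insert_subset hx (singleton_subset_iff.2 h)), hω.expect_hubbard_pair t U x i, if_pos h,
        Nat.cast_one, one_mul]
    · rw [if_neg h, if_neg h, Nat.cast_zero, zero_mul]

/-! ### The bond energy is bounded -/

/-- **The bond energy is at most `4|t|` in modulus**: `|Re ω(Φ{0, e_i})| ≤ 4|t|` for every state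
(contractivity of states and `‖Φ{0,e_i}‖ ≤ 4|t|`). [cite: BratteliRobinsonI1987, Prop. 2.3.11] -/
theorem abs_re_expect_hubbard_pair_le (ω : InfVolFermionState d) (i : Fin d) :
    |(ω.expect {0, 0 + unitVec i} ((hubbardFermionInteraction d t U).Φ {0, 0 + unitVec i})).re| ≤ 4 * |t| := by
  refine (ω.abs_re_expect_le _ _).trans ?_
  rw [hubbardFermionInteraction_apply_pair]
  exact norm_hoppingTerm_le t (fun σ => orb (PolySite.pt 0 (mem_insert_self _ _)) σ)
    (fun σ => orb (PolySite.pt (0 + unitVec i) (mem_insert_of_mem (mem_singleton_self _))) σ)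

/-! ### Two dimensions: the boxes `[0,ℓ)²` -/

/-- In the box `[0,ℓ)²`, the sites whose `i`-neighbour leaves the box are at most `ℓ`. [folklore] -/
theorem card_filter_add_unitVec_not_mem_halfOpenBox_le (ℓ : ℕ) (i : Fin 2) :
    ((halfOpenBox 2 ℓ).filter fun x => x + unitVec i ∉ halfOpenBox 2 ℓ).card ≤ ℓ := by
  classical
  have h10 : (1 : Fin 2) ≠ 0 := by decide
  have h01 : (0 : Fin 2) ≠ 1 := by decide
  -- the other coordinate
  obtain ⟨j, hji, hij⟩ : ∃ j : Fin 2, j ≠ i ∧ ∀ k : Fin 2, k ≠ i → k = j := by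
    rcases (by decide : ∀ i : Fin 2, i = 0 ∨ i = 1) i with rfl | rfl
    · exact ⟨1, h10, fun k hk => by rcases (by decide : ∀ i : Fin 2, i = 0 ∨ i = 1) k with rfl | rfl <;> simp_all⟩
    · exact ⟨0, h01, fun k hk => by rcases (by decide : ∀ i : Fin 2, i = 0 ∨ i = 1) k with rfl | rfl <;> simp_all⟩
  calc ((halfOpenBox 2 ℓ).filter fun x => x + unitVec i ∉ halfOpenBox 2 ℓ).card
      ≤ (Finset.range ℓ).card := by
        refine Finset.card_le_card_of_injOn (fun x => (x j).toNat) ?_ ?_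
        · intro x hx
          have hx' := (mem_filter.1 (mem_coe.1 hx)).1
          rw [mem_halfOpenBox] at hx'
          have := hx' j
          rw [mem_coe, mem_range]
          dsimp only
          omega
        · intro x hx y hy hxy
          have hxm := (mem_filter.1 (mem_coe.1 hx))
          have hym := (mem_filter.1 (mem_coe.1 hy))
          rw [mem_halfOpenBox] at hxm hym
          -- both have `i`-coordinate `ℓ - 1`
          have hxi : x i = (ℓ : ℤ) - 1 := by
            have h1 := hxm.1 i
            have h2 := hxm.2
            rw [mem_halfOpenBox, not_forall] at h2
            obtain ⟨k, hk⟩ := h2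
            by_cases hki : k = i
            · subst hki; simp [unitVec] at hk; omega
            · simp [unitVec, hki] at hk; exact absurd (hxm.1 k) (by omega)
          have hyi : y i = (ℓ : ℤ) - 1 := by
            have h1 := hym.1 i
            have h2 := hym.2
            rw [mem_halfOpenBox, not_forall] at h2
            obtain ⟨k, hk⟩ := h2
            by_cases hki : k = i
            · subst hki; simp [unitVec] at hk; omega
            · simp [unitVec, hki] at hk; exact absurd (hym.1 k) (by omega)
          have hxj := hxm.1 j; have hyj := hym.1 j
          have hj : x j = y j := by simp only at hxy; omega
          funext k
          by_cases hk : k = i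
          · rw [hk, hxi, hyi]
          · rw [hij k hk]; exact hj
    _ = ℓ := Finset.card_range ℓ

/-- **Mean energy versus box Hamiltonian** (two dimensions): for a translation-invariant state `ω`
and the boxes `Λ_ℓ = [0,ℓ)²`, `|ℓ² e(ω) - Re ω(H_{Λ_ℓ})| ≤ 8|t| ℓ`, where `e(ω)` is the Hubbard
energy density and `H_Λ = Σ_{X⊆Λ} Φ(X)` the free-boundary box Hamiltonian (the bonds leaving the
box, `≤ ℓ` per direction, each of energy `≤ 4|t|` in modulus, are counted with weight `1` in
`ℓ² e(ω)` and `0` in `H_Λ`). Bratteli–Robinson II §6.2.4 (the mean energy of a periodic state is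
`lim ω(H_Λ)/|Λ|`). [cite: BratteliRobinsonII1997, §6.2.4 (Prop. 6.2.38 ff.)] -/
theorem IsTranslationInvariant.abs_sq_mul_hubbardEnergyDensity_sub_re_expect_localHamiltonian_le
    {ω : InfVolFermionState 2} (hω : ω.IsTranslationInvariant) (ℓ : ℕ) :
    |(ℓ : ℝ) ^ 2 * ω.hubbardEnergyDensity t U -
        (ω.expect (halfOpenBox 2 ℓ) ((hubbardFermionInteraction 2 t U).localHamiltonian (halfOpenBox 2 ℓ))).re| ≤
      8 * |t| * ℓ := by
  classical
  set u : ℂ := ω.expect {0} ((hubbardFermionInteraction 2 t U).Φ {0}) with hu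
  set h : Fin 2 → ℂ := fun i =>
    ω.expect {0, 0 + unitVec i} ((hubbardFermionInteraction 2 t U).Φ {0, 0 + unitVec i}) with hh
  set c : Fin 2 → ℕ := fun i => ((halfOpenBox 2 ℓ).filter fun x => x + unitVec i ∈ halfOpenBox 2 ℓ).card with hc
  have he : ω.hubbardEnergyDensity t U = u.re + ∑ i, (h i).re := by
    rw [InfVolFermionState.hubbardEnergyDensity, InfVolFermionState.meanEnergy, hω.expect_hubbard_meanEnergyObs t U,
      Complex.add_re, Complex.re_sum]
  have hcard : (halfOpenBox 2 ℓ).card = ℓ ^ 2 := card_halfOpenBox 2 ℓ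
  have hH : (ω.expect (halfOpenBox 2 ℓ) ((hubbardFermionInteraction 2 t U).localHamiltonian (halfOpenBox 2 ℓ))).re =
      (ℓ : ℝ) ^ 2 * u.re + ∑ i, (c i : ℝ) * (h i).re := by
    rw [hω.expect_hubbard_localHamiltonian t U (halfOpenBox 2 ℓ), hcard, Complex.add_re, Complex.re_sum]
    congr 1
    · rw [show (((ℓ ^ 2 : ℕ)) : ℂ) = (((ℓ : ℝ) ^ 2 : ℝ) : ℂ) by push_cast; ring, Complex.re_ofReal_mul]
    · refine Finset.sum_congr rfl fun i _ => ?_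
      rw [show ((c i : ℕ) : ℂ) = ((c i : ℝ) : ℂ) by norm_cast, Complex.re_ofReal_mul]
  -- `ℓ² - ℓ ≤ c i ≤ ℓ²`
  have hc_le : ∀ i, c i ≤ ℓ ^ 2 := fun i => hcard ▸ card_filter_le _ _
  have hc_ge : ∀ i, ℓ ^ 2 ≤ c i + ℓ := fun i => by
    have hsplit := Finset.card_filter_add_card_filter_not (s := halfOpenBox 2 ℓ) (fun x => x + unitVec i ∈ halfOpenBox 2 ℓ)
    have hbd := card_filter_add_unitVec_not_mem_halfOpenBox_le ℓ i
    rw [hcard] at hsplit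
    simp only [hc]
    omega
  have hdiff : (ℓ : ℝ) ^ 2 * ω.hubbardEnergyDensity t U -
      (ω.expect (halfOpenBox 2 ℓ) ((hubbardFermionInteraction 2 t U).localHamiltonian (halfOpenBox 2 ℓ))).re =
        ∑ i, ((ℓ : ℝ) ^ 2 - c i) * (h i).re := by
    rw [he, hH]
    simp only [mul_add, Finset.mul_sum, sub_mul, Finset.sum_sub_distrib]
    ring
  rw [hdiff]
  calc |∑ i, ((ℓ : ℝ) ^ 2 - c i) * (h i).re| ≤ ∑ i, |((ℓ : ℝ) ^ 2 - c i) * (h i).re| := abs_sum_le_sum_abs _ _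
    _ ≤ ∑ _i : Fin 2, (ℓ : ℝ) * (4 * |t|) := by
        refine Finset.sum_le_sum fun i _ => ?_
        rw [abs_mul]
        refine mul_le_mul ?_ (abs_re_expect_hubbard_pair_le t U ω i) (abs_nonneg _) (Nat.cast_nonneg _)
        have h1 : (c i : ℝ) ≤ (ℓ : ℝ) ^ 2 := by exact_mod_cast hc_le i
        have h2 : (ℓ : ℝ) ^ 2 ≤ c i + ℓ := by exact_mod_cast hc_ge i
        rw [abs_of_nonneg (by linarith)]
        linarith
    _ = 8 * |t| * ℓ := by simp; ring

end InfVolFermionState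

end Literature.MathematicalPhysics.QuantumLattice

end
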